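import Summits.QuantumFields.YangMills.Theorems.BalabanUVNodesN07ChartTopBoxDataSmall
import HarnessLib

/-!
# N07 [B11] (= [15] = [Balaban1985Variational]) Sect. F — THE LETTER `δ̂` ON PRINT's WHOLE WINDOW `□̃` SUPPLIED AT THE RECORD (MODULE 69b's twin for the text of record 60′): at a
# MEETING, PRINT-MARGIN-CLEAN datum of the token's run, «(7) for V» holds on the `□̃` box — `PlaqSmallOn (boxPlaqs (tLo cornerP ρ) (tHi cornerP sideP ρ)) ((1 + 2C_L)·δ_j) (M^j U)` —
# from the token's own hypotheses (the fibre `AgreeOn`, the data's (7) `DataSmall7PTop`) and the run's letters (separation, grid saturation, the knit's floor)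

Cell `pub-ymgap`, seat `pub-ymgap-dag-n07-e` g25 (FAN-OUT §N07 row s3; LANE OWNER of the K0 road), MODULE 69b″ (plan g90 RULING A3 (4): queue (c) «δ̂ on the □̃ box» released).
`--kind proof --supports stmt-QuantumFields-20541 --as helper` (K0⁷); count-neutral; def-free.  [15] = [Balaban1985Variational]; [3] = [Balaban1985Averaging]; [6] = [Balaban1985RegularSpaces];
[III] = [Balaban1988Convergent].

WHAT THIS CLOSES BY NAME.  MODULE 62″ (`…N07NormalisationWideRows.NrmOfRecordWide.norm_mlog_shearedAvgIter_top_le`) gives the chart's TOP rows under the text of record `NrmOfRecordWide`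
(MODULE 60′: top axial gauge on print's `□̃ = [tLo, tHi] = [cornerP − 2ρ, cornerP + sideP − 1 + 2ρ]` rooted at `ctr`) modulo ONE displayed letter
`hV : PlaqSmallOn (boxPlaqs (tLo (cornerP idx) ρ) (tHi (cornerP idx) (sideP) ρ)) δ̂ (Averaging.iter (avOfRecord F N K) j U)` — «(7) for V» on the whole `□̃` box.  THIS FILE supplies it
with the SAME constant and the SAME hypotheses as MODULE 69b (`…ChartTopBoxDataSmall.plaqSmallOn_chartTopBox_iter_of_data`, p673750, the chart-box version): `δ̂ := (1 + 2·C_L)·δ_j`,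
`C_L = (L² + 6((d+2)L)²)·(4(d−1)(2L−1) + 1)`, at every datum `(j, idx)`, `1 ≤ j ≤ k`, of a separated run whose print box MEETS `Ω_j` (within `3`) and is PRINT-MARGIN-CLEAN (`j = k ∨` the
`2ρ`-widened print box — which IS the `□̃` box, MODULE 66 `wbox_two_mul_eq_tcube` — carries no point of `Ω_{j+1}`); the floor `(11d + 4ρ + Mc)·L + 3 ≤ ν.M₁` already covers the `2ρ` clamp
distance of `□̃` (69b's clamp went through `□̃` too).  HOW: MODULE 69a part 2 `plaqSmallOn_boxPlaqs_iter_succ` on the box `[tLo, tHi]` with its three geometric clauses discharged: (i) margin —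
the unit boxes of the `□̃` labels lie in the `2ρ`-widened print box (§1 `unitBox_subset_printWindowBox`), which misses `Ω_{j+1}` by the premise; (ii) collar (`j ≥ 2`) — every such point is
within `2ρ·Lʲ` of the print box (§1 `exists_mem_box_within_of_mem_printWindowBox`: 36a's clamp for `tcube`), hence projects into `Ω_{j−1}` (57a at `E = 2ρ`); (iii) support (`j = 1`) —
within `ν.M₁` of the meeting site.  Everything else is 69b verbatim.

WHAT IS PROVED (sorry-free; no definition; axioms standard; by-name composition).  §1 `unitBox_subset_printWindowBox` · `exists_mem_box_within_of_mem_printWindowBox`; §2 ★★★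
`plaqSmallOn_printWindow_iter_of_data` (the letter `hV` of MODULE 62″ at the record, `δ̂ = (1 + 2C_L)·δ_j`).

HONEST SCOPE.  Count-neutral; the fibre, the data's (7), the ranges and the run's letters are HYPOTHESES (the token's ∕ the knit's own binders); the crude constant `C_L` is MODULE 68's;
`NrmOfRecordWide` ∕ HS3NORM ∕ HCHART-MEET-NORM ∕ HBUDGET-NORM stay displayed in the knit (67c), the `Nrm` door CONDITIONAL (`HThm4Rec`, ruling A3); K0⁷ ∕ K1⁹ NOT closed; N07 NOT discharged and
NOT claimable on road (β); counts unmoved (typed 28∕28 · discharged 7∕28); one finite 𝕋⁴ programme at fixed ε — the route closes the conditional finite-𝕋⁴ rung `BalabanLadder.UV` ONLY;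
the YM mass gap (Clay) is NOT proved by any of this; nothing continuum ∕ ℝ⁴ ∕ OS.  No `sorry`, no `def`, no `instance`, no `notation`.

References: [15] (7) p. 278 L20–33, (13) p. 280, (144) p. 300, (147) p. 301, (160) p. 303; [3] Prop. 1 (51) pp. 25–26; [6] p. 98, (1.3)–(1.6) p. 77; [III] p. 255, (2.2) p. 255,
(2.10)–(2.11), (2.13) p. 256.
-/

set_option autoImplicit false

noncomputable section
open scoped BigOperators Matrix.Norms.L2Operator

namespace Summit.QuantumFields.YangMills.BalabanUVNodes.N07PrintWindowDataSmall

open Literature.MathematicalPhysics.QuantumFieldTheory.Balaban1983to89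
open Literature.MathematicalPhysics.QuantumFieldTheory.Balaban1983to89.Node00
open Literature.MathematicalPhysics.QuantumFieldTheory.Balaban1983to89.B15DeterminingSets
open T4Continuum (T4Family)
open T4AxialGaugeSmallField (castSite boxPlaqs)
open B15Eq112TorusCover (cover)
open B14DomainGeom (Pt Within)
open B8Eq131Cubes (box bLo bHi tLo tHi tcube)
open B5Eq118OneStroke (iterBlockOf)
open ExpMeanLog (deltaSU)
open Summit.QuantumFields.YangMills.BalabanUVNodes.N07ChartTopBoxPlaquettes (plaqSmallOn_boxPlaqs_iter_succ)
open Summit.QuantumFields.YangMills.BalabanUVNodes.N07ChartTopBoxPlaquetteValues (mem_box_of_mem_unitBox)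
open Summit.QuantumFields.YangMills.BalabanUVNodes.N07SplitClauseLevelRaisingMarginWide (wbox_two_mul_eq_tcube)
open Summit.QuantumFields.YangMills.BalabanUVNodes.N07ChartTopBoxDataSmall (two_mul_L_lt_sitesPerDir)
open Summit.QuantumFields.YangMills.BalabanUVNodes.N07RecordDomainsAdm22 (blockSat_seqOfRecord)

/-! ## §1  Geometry of print's window `□̃`: unit boxes, the clamp to the print box -/

section Geometry

variable {P : Params}

/-- The unit box of a label of the `□̃` box `[tLo c ρ, tHi c S ρ] = [c − 2ρ, c + S − 1 + 2ρ]` lies in the `2ρ`-widened print box (whose fine trace is `□̃`, MODULE 66 `wbox_two_mul_eq_tcube`).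
[cite: Balaban1985Variational, (144) p.300; Balaban1985RegularSpaces, p.98 («a cube which we denote by □̃»)] -/
theorem unitBox_subset_printWindowBox (c : Pt P.d) (S ρ j : ℕ) {t : Pt P.d} (ht : t ∈ Set.Icc (tLo c ρ) (tHi c S ρ)) :
    box P.L t 1 j ⊆ box P.L (c - ((2 * ρ : ℕ) : Pt P.d)) (S + 2 * (2 * ρ)) j := by
  have hcorner : (c - ((2 * ρ : ℕ) : Pt P.d)) = tLo c ρ := by
    funext i
    simp only [tLo, Pi.sub_apply, Pi.natCast_apply]
    push_cast; ring
  intro z hz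
  rw [hcorner]
  refine mem_box_of_mem_unitBox ht (fun i => ?_) hz
  simp only [tLo, tHi]
  push_cast; linarith

/-- **THE CLAMP**: every point of the unit box of a `□̃` label is within `2ρ·Lʲ` of a point of the print box (`1 ≤ S`): 36a's clamp for `tcube`.
[cite: Balaban1985Variational, (144) p.300; Balaban1985RegularSpaces, p.98] -/
theorem exists_mem_box_within_of_mem_printWindowBox (c : Pt P.d) {S : ℕ} (hS : 1 ≤ S) (ρ j : ℕ) {t : Pt P.d}
    (ht : t ∈ Set.Icc (tLo c ρ) (tHi c S ρ)) {z : Pt P.d} (hz : z ∈ box P.L t 1 j) :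
    ∃ y ∈ box P.L c S j, Within (((2 * ρ * P.L ^ j : ℕ) : ℤ)) z y := by
  have hz' : z ∈ tcube P.L c S ρ j := by
    rw [← wbox_two_mul_eq_tcube]
    exact unitBox_subset_printWindowBox c S ρ j ht hz
  exact exists_mem_box_within_of_mem_tcube_of_corner (Nat.one_le_iff_ne_zero.mpr (by have := P.hL.2; omega)) hS
    (fun i => by push_cast; linarith) (fun i => by push_cast; linarith) j hz'

end Geometry

/-! ## §2  The letter `δ̂` at a meeting, print-margin-clean datum of the run -/

section Record

variable (F : T4Family) (N : ℕ) [NeZero N]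

/-- ★★★ **«(7) FOR V» ON PRINT's WHOLE WINDOW `□̃`, AT THE RECORD** — MODULE 62″'s displayed letter `hV` with `δ̂ = (1 + 2C_L)·δ_j`: for a separated run `s` (`Sect2.SeqSeparated ν.M₁ s`) with grid
saturation, the knit's floor `(11d + 4ρ + Mc)·L + 3 ≤ ν.M₁`, `1 ≤ ρ`, `1 ≤ Mc`, level room `j + 1 ≤ m + K`, the token's ranges (`0 < δ_n ≤ a₁`, `δ_n ≤ 2δ_{n+1}`) and the guard
`(((d+2)L)²∕4)·((4(d−1)(2L−1)+1)·a₁) < δ_N`; data `W` with (7) for the support of record and a field `U` on the fibre; at every datum `(j, idx)`, `1 ≤ j ≤ k`, whose print box meets `Ω_j`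
within `3` and is PRINT-MARGIN-CLEAN (`j = k ∨` the `2ρ`-widened print box misses `Ω_{j+1}`): every level-`j` plaquette of `M^j U` based in `□̃ = [tLo cornerP ρ, tHi cornerP sideP ρ]` is
`< (1 + 2C_L)·δ_j`, `C_L = (L² + 6((d+2)L)²)·(4(d−1)(2L−1) + 1)`.
[cite: Balaban1985Variational, (7) p.278 L20–33, (13) p.280, (144) p.300, (147) p.301, (160) p.303; Balaban1985Averaging, Prop. 1 (51) pp.25–26; Balaban1988Convergent, p.255, (2.2), (2.10)–(2.13) pp.255–257] -/
theorem plaqSmallOn_printWindow_iter_of_data {ν : Stage7Numerics} {M : ℕ} {g : ℕ → ℝ} {K k : ℕ} (s : SeqOfRecord F ν M g K k)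
    (hsep : Sect2.SeqSeparated ν.M₁ s) (hkK : k ≤ (F.P K).m + (F.P K).K)
    (hgrid : ∀ j : ℕ, 1 ≤ j → j ≤ k → dCubeSide (F.P K).L M (RkOfRecord (F.P K).L ν.r (g j)) j ∣ (F.P K).sitesPerDir 0)
    {Mc ρ : ℕ} (hMc : 1 ≤ Mc) (hρ : 1 ≤ ρ) (hfloor : (11 * (F.P K).d + 4 * ρ + Mc) * (F.P K).L + 3 ≤ ν.M₁)
    {δ : ℕ → ℝ} {a₁ : ℝ} (hδ : ∀ n, n ≤ k → 0 < δ n ∧ δ n ≤ a₁) (hcompδ : ∀ n, n < k → δ n ≤ 2 * δ (n + 1))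
    (hguard : (((((F.P K).d + 2) * (F.P K).L : ℕ) : ℝ) ^ 2 / 4) * ((4 * (((((F.P K).d - 1 : ℕ) : ℝ)) * ((2 * (F.P K).L - 1 : ℕ) : ℝ)) + 1) * a₁) < deltaSU (Fin N))
    (W : MSField (F.P K) (SU N)) (h7 : Sect2.DataSmall7PTop (avOfRecord F N K) s.Ω (suppDomOfRecord F ν K s.Ω) k δ W)
    (U : GaugeField (F.P K) 0 (SU N)) (hfib : AgreeOn (genSet s.Ω k) (avgFamily (avOfRecord F N K) U) W)
    {j : ℕ} (hj1 : 1 ≤ j) (hjk : j ≤ k) (hjK : j + 1 ≤ (F.P K).m + (F.P K).K) (idx : Pt (F.P K).d)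
    (hmeet : ∃ x ∈ box (F.P K).L (cornerP (F.P K) Mc ρ idx) (sideP (F.P K) Mc ρ) j, ∃ y : Pt (F.P K).d, cover (F.P K) y ∈ s.Ω j ∧ Within ((3 : ℕ) : ℤ) x y)
    (hclean : j = k ∨ ∀ z ∈ box (F.P K).L (cornerP (F.P K) Mc ρ idx - ((2 * ρ : ℕ) : Pt (F.P K).d)) (sideP (F.P K) Mc ρ + 2 * (2 * ρ)) j, cover (F.P K) z ∉ s.Ω (j + 1)) :
    PlaqSmallOn (boxPlaqs (tLo (cornerP (F.P K) Mc ρ idx) ρ) (tHi (cornerP (F.P K) Mc ρ idx) (sideP (F.P K) Mc ρ) ρ))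
      ((1 + 2 * ((((F.P K).L : ℝ) ^ 2 + 6 * ((((F.P K).d + 2) * (F.P K).L : ℕ) : ℝ) ^ 2) * (4 * (((((F.P K).d - 1 : ℕ) : ℝ)) * ((2 * (F.P K).L - 1 : ℕ) : ℝ)) + 1))) * δ j)
      (Averaging.iter (avOfRecord F N K) j U) := by
  -- write `j = m + 1`
  obtain ⟨m, rfl⟩ : ∃ m, j = m + 1 := ⟨j - 1, by omega⟩
  set c : Pt (F.P K).d := cornerP (F.P K) Mc ρ idx with hc
  set S : ℕ := sideP (F.P K) Mc ρ with hS
  set CL : ℝ := (((F.P K).L : ℝ) ^ 2 + 6 * ((((F.P K).d + 2) * (F.P K).L : ℕ) : ℝ) ^ 2) * (4 * (((((F.P K).d - 1 : ℕ) : ℝ)) * ((2 * (F.P K).L - 1 : ℕ) : ℝ)) + 1) with hCL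
  have hCL0 : 0 ≤ CL := by positivity
  have hν0 : 0 < ν.M₁ := by omega
  have hν1 : 1 ≤ ν.M₁ := hν0
  have hρ0 : 0 < ρ := hρ
  have hS1 : 1 ≤ S := by have := le_sideP (P := F.P K) Mc hρ0; omega
  -- the letters of MODULE 69a: `δ₁ = δ_{m+1}`, `a = δ_m ≤ a₁`
  have hδm : 0 < δ m := (hδ m (by omega)).1
  have hδm1 : δ m ≤ a₁ := (hδ m (by omega)).2
  have hδj : 0 ≤ δ (m + 1) := (hδ (m + 1) hjk).1.le
  have hguard' : (((((F.P K).d + 2) * (F.P K).L : ℕ) : ℝ) ^ 2 / 4) * ((4 * (((((F.P K).d - 1 : ℕ) : ℝ)) * ((2 * (F.P K).L - 1 : ℕ) : ℝ)) + 1) * δ m) < deltaSU (Fin N) := by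
    refine lt_of_le_of_lt ?_ hguard
    gcongr
  have hN : 2 * (F.P K).L < (F.P K).sitesPerDir m := two_mul_L_lt_sitesPerDir (by omega)
  -- block saturation of `Ω_{m+1}` (grid numerics)
  have hsat : ∀ x x' : Site (F.P K) 0, iterBlockOf (m + 1) x = iterBlockOf (m + 1) x' → x ∈ s.Ω (m + 1) → x' ∈ s.Ω (m + 1) :=
    fun x x' => blockSat_seqOfRecord F ν M g K k hkK s hgrid (m + 1) x x' hj1 hjk
  -- the data's clauses
  have h7succ := h7.2 m hjk
  have h7m : ∀ m', m' + 1 = m → PlaqSmallOn (Sect2.printedPlaqs s.Ω k (m' + 1)) (δ m)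
      (Sect2.mixedField (avOfRecord F N K) (genSet s.Ω k (m' + 1)) (W (m' + 1)) (W m')) := by
    intro m' hm'
    subst hm'
    exact h7.2 m' (by omega)
  have h70 : m = 0 → PlaqSmallOn (Sect2.printedPlaqsTop s.Ω (suppDomOfRecord F ν K s.Ω) k) (δ m) (W 0) := by
    intro h0; subst h0; exact h7.1
  -- (i) MARGIN: the unit boxes of the `□̃` labels miss `Ω_{m+2}` (print-margin-clean; at the top `Ω_{k+1} = ∅`)
  have hfar : ∀ t ∈ Set.Icc (tLo c ρ) (tHi c S ρ),
      ∀ z ∈ box (F.P K).L t 1 (m + 1), cover (F.P K) z ∉ s.Ω (m + 2) := by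
    intro t ht z hz
    rcases hclean with htop | hcl
    · rw [s.Ω_off (m + 2) (by omega)]; exact Set.notMem_empty _
    · exact hcl z (unitBox_subset_printWindowBox c S ρ (m + 1) ht hz)
  -- (ii) COLLAR (`m ≥ 1`): every such point projects into `Ω_m` (within `2ρ·L^{m+1}` of the print box; 57a at `E = 2ρ`)
  obtain ⟨x₀, hx₀, y₀, hy₀, hxy₀⟩ := hmeet
  have hcol : 1 ≤ m → ∀ t ∈ Set.Icc (tLo c ρ) (tHi c S ρ),
      ∀ z ∈ box (F.P K).L t 1 (m + 1), cover (F.P K) z ∈ s.Ω m := by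
    intro h1 t ht z hz
    obtain ⟨y', hy', hzy'⟩ := exists_mem_box_within_of_mem_printWindowBox c hS1 ρ (m + 1) ht hz
    have hfl : 11 * (F.P K).d + 2 * ρ + Mc + 3 + 2 * ρ ≤ ν.M₁ := by
      have hL1 : 1 ≤ (F.P K).L := (F.P K).L_pos
      have : 11 * (F.P K).d + 4 * ρ + Mc ≤ (11 * (F.P K).d + 4 * ρ + Mc) * (F.P K).L := Nat.le_mul_of_pos_right _ hL1
      omega
    have h := Sect2.cover_mem_Ω_pred_of_near_box_propCubeP_box (P := F.P K) hν1 s hsep (Dw := 3) (E := 2 * ρ) hfl (n := m + 1) (by omega) hjk hx₀ hy₀ hxy₀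
      (z := z) (y' := y') hy' (by simpa [mul_comm, mul_assoc] using hzy')
    simpa using h
  -- (iii) SUPPORT (`m = 0`): every such point lies within `ν.M₁` of the meeting site, hence in `hullD ν.M₁ 1 (Ω 1)`
  have hsupp : m = 0 → ∀ t ∈ Set.Icc (tLo c ρ) (tHi c S ρ),
      ∀ z ∈ box (F.P K).L t 1 (m + 1), cover (F.P K) z ∈ suppDomOfRecord F ν K s.Ω := by
    intro h0 t ht z hz
    subst h0
    obtain ⟨y', hy', hzy'⟩ := exists_mem_box_within_of_mem_printWindowBox c hS1 ρ (0 + 1) ht hz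
    have hbox := within_of_mem_box_of_mem_box (F.P K).L hy' hx₀
    have hw := (hzy'.triangle hbox).triangle hxy₀
    rw [suppDomOfRecord_eq]
    refine cover_mem_hullD_one_of_within hν0 hy₀ (hw.mono ?_)
    have hSle : (S : ℤ) ≤ Mc + 11 * (F.P K).d + 2 * ρ := by exact_mod_cast sideP_le (P := F.P K) Mc ρ
    have hf : (((11 * (F.P K).d + 4 * ρ + Mc) * (F.P K).L + 3 : ℕ) : ℤ) ≤ ν.M₁ := by exact_mod_cast hfloor
    push_cast at hf ⊢
    have hL0 : (0 : ℤ) ≤ (F.P K).L := by positivity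
    nlinarith
  -- MODULE 69a part 2, then `δ_m ≤ 2δ_{m+1}`
  have hmain := plaqSmallOn_boxPlaqs_iter_succ F N K s.Ω W U hjk (by omega) hfib hsat hδj hδm hN hguard' h7succ h7m h70 hfar hcol hsupp
  intro p hp
  refine (hmain p hp).trans_le ?_
  have h2 : δ m ≤ 2 * δ (m + 1) := hcompδ m (by omega)
  have hAB : (((F.P K).L : ℝ) ^ 2 + 6 * ((((F.P K).d + 2) * (F.P K).L : ℕ) : ℝ) ^ 2) *
      ((4 * (((((F.P K).d - 1 : ℕ) : ℝ)) * ((2 * (F.P K).L - 1 : ℕ) : ℝ)) + 1) * δ m) = CL * δ m := by rw [hCL]; ring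
  rw [hAB]
  nlinarith [mul_le_mul_of_nonneg_left h2 hCL0]

end Record

end Summit.QuantumFields.YangMills.BalabanUVNodes.N07PrintWindowDataSmall

end
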